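import Mathlib

/-!
# Skew-cut certificate, v3 (A-POSTERIORI certifier): the kernel-checkable algebra
(selfsim g4, cell `ns-blowup`, 2026-08-25)

HONEST FRAMING (human ruling D-0035): nothing here is a claim about Navier–Stokes blow-up.
WHAT THIS IS NOT: not NS evidence. Companion of `SkewCutCertificate.lean` (selfsim g3: the lemmas
behind Theorems 1/1′/2 of `selfsim/SKEWCUT-CERT.md`, the a-posteriori certification format for one
real eigenvalue of the MODEL operator «NS linearised about the forced ABC flow», crux X0 of lane N1*).

The v3 certifier `selfsim/certx0v3/skewcut_certify_v3.py` (method note `SKEWCUT-CERT-V3.md`)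
certifies the SAME hypotheses (nonsingularity and sign of `det A⁽ᴷ⁾(x)`, the shell-K block `N_K` of
the inverse, `H_K`, `Q_K`) WITHOUT propagating balls through the shell recursion: floating point
PROPOSES (block-LU factors, approximate inverse, approximate solutions), ball arithmetic VERIFIES
one-level identities. The four finite-dimensional facts it relies on are kernel here, for real
square matrices with the ∞-operator norm (max row sum, `Matrix.linftyOpNormedRing`, via
`open scoped Matrix.Norms.Operator`) and the sup norm on vectors:

* (V1) RUMP'S TEST — `isUnit_det_of_norm_one_sub_mul_lt`, `norm_inv_le_of_norm_one_sub_mul_lt`: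
  for ANY matrix `R`, `‖1 − R A‖ < 1` ⇒ `A` nonsingular and `‖A⁻¹‖ ≤ ‖R‖ / (1 − ‖1 − R A‖)`.
* (V2) RESIDUAL BOUND — `norm_inv_mulVec_sub_le`: `‖A⁻¹f − y‖ ≤ ‖A⁻¹‖·‖f − A y‖` for ANY proposed
  solution `y` (entrywise radius of the certified columns of the bordered inverse).
* (V3) BORDERED INVERSE — `bordered_inverse`: if `[[X, y], [z, ω]]` is a right inverse of the
  bordered matrix `[[A, r], [l, 0]]` with corner `ω ≠ 0`, then `A (X − ω⁻¹ • (y z)) = 1` (so `A` is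
  nonsingular and every block of `A⁻¹`, e.g. `N_K`, is read off `X, y, z, ω`) and
  `det A = ω · det [[A, r], [l, 0]]` (the sign of `det A` from the signs of `det A_b` and `ω`).
* (V4) SIGN FROM AN APPROXIMATE FACTORISATION — `det_mul_det_sub_pos_of_segment` (a segment of
  nonsingular matrices carries one determinant sign: continuity + intermediate value theorem),
  `det_one_sub_ne_zero_of_norm_lt_one` / `det_one_sub_pos_of_norm_lt_one` (Neumann: `‖F‖ < 1` ⇒
  `det (1 − F) > 0`), `det_mul_det_sub_pos_of_norm_inv_mul_lt`: `‖A⁻¹E‖ < 1` ⇒ `det A` and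
  `det (A − E)` have the same sign; applied with `A = A_b` and `A − E = L̃Ũ` the proposed block-LU
  product, whose determinant sign is the product of the signs of its diagonal blocks.

Mathlib only; no new definitions.
-/

namespace Summit.NavierStokesRegularity.FluidComputer.SkewCutAPosteriori

section Segment

variable {n : Type*} [Fintype n] [DecidableEq n]

/-- **Sign constancy along a segment of nonsingular matrices ((V4), finite core).** If every
matrix `A − t•E`, `t ∈ [0,1]`, is nonsingular then `det A` and `det (A − E)` have the same sign:
`0 < det A · det (A − E)` (continuity of `det` + intermediate value theorem). In the v3 certifier
`A` is the bordered section `A_b`, `E = A_b − L̃Ũ` the ball-evaluated residual of the proposed block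
LU factorisation, and nonsingularity along the segment comes from `‖A_b⁻¹E‖ < 1`. -/
theorem det_mul_det_sub_pos_of_segment (A E : Matrix n n ℝ)
    (h : ∀ t ∈ Set.Icc (0:ℝ) 1, (A - t • E).det ≠ 0) : 0 < A.det * (A - E).det := by
  let f : ℝ → ℝ := fun t => (A - t • E).det
  have hcont : Continuous f := by
    apply Continuous.matrix_det
    fun_prop
  have hf0 : f 0 = A.det := by simp [f]
  have hf1 : f 1 = (A - E).det := by simp [f]
  rw [← hf0, ← hf1]
  by_contra hle
  have hle : f 0 * f 1 ≤ 0 := not_lt.mp hle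
  have hzero : ∃ t ∈ Set.Icc (0:ℝ) 1, f t = 0 := by
    rcases le_or_gt (f 0) 0 with h0 | h0
    · rcases lt_or_ge (f 1) 0 with h1 | h1
      · have hz : f 0 * f 1 = 0 := le_antisymm hle (mul_nonneg_of_nonpos_of_nonpos h0 h1.le)
        rcases mul_eq_zero.mp hz with hz | hz
        · exact ⟨0, ⟨le_refl _, zero_le_one⟩, hz⟩
        · exact ⟨1, ⟨zero_le_one, le_refl _⟩, hz⟩
      · exact intermediate_value_Icc zero_le_one hcont.continuousOn ⟨h0, h1⟩
    · have h1 : f 1 ≤ 0 := by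
        by_contra h1
        push Not at h1
        exact absurd (mul_pos h0 h1) (not_lt.mpr hle)
      exact intermediate_value_Icc' zero_le_one hcont.continuousOn ⟨h1, h0.le⟩
  obtain ⟨t, ht, hft⟩ := hzero
  exact h t ht hft

end Segment

section Neumann

variable {n : Type*} [Fintype n] [DecidableEq n]

open scoped Matrix.Norms.Operator

/-- **Neumann test (∞-operator norm).** If `‖F‖ < 1` for the max-row-sum operator norm
(`Matrix.linftyOpNormedRing`) then `1 − F` is nonsingular: a kernel vector `v` would satisfy
`‖v‖ = ‖F v‖ ≤ ‖F‖‖v‖ < ‖v‖`. -/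
theorem det_one_sub_ne_zero_of_norm_lt_one (F : Matrix n n ℝ) (hF : ‖F‖ < 1) :
    (1 - F).det ≠ 0 := by
  intro hdet
  obtain ⟨v, hv, hFv⟩ := (Matrix.exists_mulVec_eq_zero_iff).mpr hdet
  have hv' : F.mulVec v = v := by
    have : (1 - F).mulVec v = v - F.mulVec v := by rw [Matrix.sub_mulVec, Matrix.one_mulVec]
    rw [this] at hFv
    exact (sub_eq_zero.mp hFv).symm
  have hnorm : ‖v‖ ≤ ‖F‖ * ‖v‖ := by
    calc ‖v‖ = ‖F.mulVec v‖ := by rw [hv']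
      _ ≤ ‖F‖ * ‖v‖ := Matrix.linfty_opNorm_mulVec F v
  have hvpos : 0 < ‖v‖ := norm_pos_iff.mpr hv
  nlinarith

/-- `0 < det (1 − F)` when `‖F‖ < 1` (∞-operator norm): the whole segment `1 − t•F` is
nonsingular, then `det_mul_det_sub_pos_of_segment`. -/
theorem det_one_sub_pos_of_norm_lt_one (F : Matrix n n ℝ) (hF : ‖F‖ < 1) :
    0 < (1 - F).det := by
  have hseg : ∀ t ∈ Set.Icc (0:ℝ) 1, ((1 : Matrix n n ℝ) - t • F).det ≠ 0 := by
    intro t ht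
    apply det_one_sub_ne_zero_of_norm_lt_one
    calc ‖t • F‖ = |t| * ‖F‖ := by rw [norm_smul, Real.norm_eq_abs]
      _ ≤ 1 * ‖F‖ := by
          gcongr
          exact abs_le.mpr ⟨by linarith [ht.1], ht.2⟩
      _ < 1 := by rw [one_mul]; exact hF
  have := det_mul_det_sub_pos_of_segment (1 : Matrix n n ℝ) F hseg
  simpa using this

/-- **v3 (V4): sign of a determinant from an approximate factorisation.** If `A` is nonsingular and
the residual `E` satisfies `‖A⁻¹E‖ < 1` (∞-operator norm), then `det A` and `det (A − E)` have the
same sign. Used with `A = A_b` (bordered section, `‖A_b⁻¹‖ ≤ β_b` by Rump's test) and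
`A − E = L̃_bŨ_b` the proposed block-LU product, whose determinant sign is read off the diagonal
blocks. -/
theorem det_mul_det_sub_pos_of_norm_inv_mul_lt (A E : Matrix n n ℝ) (hA : IsUnit A.det)
    (h : ‖A⁻¹ * E‖ < 1) : 0 < A.det * (A - E).det := by
  have hfac : A - E = A * (1 - A⁻¹ * E) := by
    rw [Matrix.mul_sub, Matrix.mul_one, ← Matrix.mul_assoc, Matrix.mul_nonsing_inv _ hA,
      Matrix.one_mul]
  rw [hfac, Matrix.det_mul]
  have hpos := det_one_sub_pos_of_norm_lt_one (A⁻¹ * E) h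
  have hA2 : 0 < A.det * A.det := mul_self_pos.mpr hA.ne_zero
  have : A.det * (A.det * (1 - A⁻¹ * E).det) = (A.det * A.det) * (1 - A⁻¹ * E).det := by ring
  rw [this]
  exact mul_pos hA2 hpos

/-- **v3 (V1): Rump's nonsingularity test.** For ANY matrix `R` (in practice a floating-point
approximate inverse), `‖1 − R A‖ < 1` (∞-operator norm) implies that `A` is nonsingular. -/
theorem isUnit_det_of_norm_one_sub_mul_lt (R A : Matrix n n ℝ) (h : ‖1 - R * A‖ < 1) :
    IsUnit A.det := by
  have hne : (1 - (1 - R * A)).det ≠ 0 := det_one_sub_ne_zero_of_norm_lt_one _ h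
  rw [sub_sub_cancel, Matrix.det_mul] at hne
  exact isUnit_iff_ne_zero.mpr (right_ne_zero_of_mul hne)

/-- **v3 (V1): Rump's bound on the inverse.** `‖1 − R A‖ < 1` implies
`‖A⁻¹‖ ≤ ‖R‖ / (1 − ‖1 − R A‖)` (∞-operator norm): from `A⁻¹ = (1 − R A)A⁻¹ + R`. This is the
certified constant `β_b` of the v3 certifier. -/
theorem norm_inv_le_of_norm_one_sub_mul_lt (R A : Matrix n n ℝ) (h : ‖1 - R * A‖ < 1) :
    ‖A⁻¹‖ ≤ ‖R‖ / (1 - ‖1 - R * A‖) := by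
  have hA := isUnit_det_of_norm_one_sub_mul_lt R A h
  have hid : A⁻¹ = (1 - R * A) * A⁻¹ + R := by
    rw [Matrix.sub_mul, Matrix.one_mul, Matrix.mul_assoc, Matrix.mul_nonsing_inv _ hA,
      Matrix.mul_one, sub_add_cancel]
  have hle : ‖A⁻¹‖ ≤ ‖1 - R * A‖ * ‖A⁻¹‖ + ‖R‖ := by
    calc ‖A⁻¹‖ = ‖(1 - R * A) * A⁻¹ + R‖ := by rw [← hid]
      _ ≤ ‖(1 - R * A) * A⁻¹‖ + ‖R‖ := norm_add_le _ _
      _ ≤ ‖1 - R * A‖ * ‖A⁻¹‖ + ‖R‖ := by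
          gcongr
          exact norm_mul_le _ _
  have hpos : 0 < 1 - ‖1 - R * A‖ := by linarith
  rw [le_div_iff₀ hpos]
  nlinarith [norm_nonneg A⁻¹, norm_nonneg (1 - R * A)]

/-- **v3 (V2): residual bound for a proposed solution.** For nonsingular `A`, any right-hand side
`f` and ANY proposed solution `y`, the true solution `A⁻¹f` satisfies
`‖A⁻¹f − y‖ ≤ ‖A⁻¹‖ · ‖f − A y‖` (sup norm on vectors, ∞-operator norm on matrices). With
`‖A⁻¹‖ ≤ β_b` this gives the entrywise radius `ρ` of the certified columns of `A_b⁻¹`. -/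
theorem norm_inv_mulVec_sub_le (A : Matrix n n ℝ) (hA : IsUnit A.det) (f y : n → ℝ) :
    ‖A⁻¹.mulVec f - y‖ ≤ ‖A⁻¹‖ * ‖f - A.mulVec y‖ := by
  have : A⁻¹.mulVec f - y = A⁻¹.mulVec (f - A.mulVec y) := by
    rw [Matrix.mulVec_sub, Matrix.mulVec_mulVec, Matrix.nonsing_inv_mul _ hA, Matrix.one_mulVec]
  rw [this]
  exact Matrix.linfty_opNorm_mulVec _ _

end Neumann

section Border

variable {n : Type*} [Fintype n] [DecidableEq n]

/-- **v3 (V3): bordered-inverse algebra.** Let `A_b = [[A, r], [l, 0]]` be the section bordered by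
one column `r` and one row `l`, and let `[[X, y], [z, ω]]` be a right inverse of `A_b` (in the
certifier: the certified enclosure of `A_b⁻¹`). If the corner `ω` is nonzero then
(i) `A` is nonsingular with `A⁻¹ = X − ω⁻¹ • (y z)` — in particular every block of `A⁻¹`, e.g. the
shell-K block `N_K`, is read off `X, y, z, ω`; and (ii) `det A = ω · det A_b`, so the SIGN of
`det A` is the sign of `det A_b` times the sign of `ω`. -/
theorem bordered_inverse (A X : Matrix n n ℝ) (r y : Matrix n Unit ℝ) (l z : Matrix Unit n ℝ)
    (ω : Matrix Unit Unit ℝ)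
    (h : Matrix.fromBlocks A r l 0 * Matrix.fromBlocks X y z ω = 1) (hω : ω () () ≠ 0) :
    A * (X - (ω () ())⁻¹ • (y * z)) = 1 ∧
      A.det = ω () () * (Matrix.fromBlocks A r l 0).det := by
  set c := ω () () with hc
  have hωc : ω = c • (1 : Matrix Unit Unit ℝ) := by
    ext i j
    cases i; cases j
    simp [c]
  have hmul := h
  rw [Matrix.fromBlocks_multiply, ← Matrix.fromBlocks_one, Matrix.fromBlocks_inj] at hmul
  obtain ⟨h11, h12, -, -⟩ := hmul
  -- h11 : A * X + r * z = 1 ;  h12 : A * y + r * ω = 0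
  have hrω : r * ω = c • r := by rw [hωc, Matrix.mul_smul, Matrix.mul_one]
  have hr : r = -(c⁻¹ • (A * y)) := by
    have hcr : c • r = -(A * y) := by rw [← hrω]; exact eq_neg_of_add_eq_zero_right h12
    calc r = c⁻¹ • (c • r) := by rw [smul_smul, inv_mul_cancel₀ hω, one_smul]
      _ = -(c⁻¹ • (A * y)) := by rw [hcr, smul_neg]
  have h1 : A * (X - c⁻¹ • (y * z)) = 1 := by
    have hrz : r * z = -(c⁻¹ • (A * y * z)) := by rw [hr, Matrix.neg_mul, Matrix.smul_mul]
    rw [Matrix.mul_sub, Matrix.mul_smul, ← Matrix.mul_assoc, ← h11, hrz, sub_eq_add_neg]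
  refine ⟨h1, ?_⟩
  -- determinants
  set B := X - c⁻¹ • (y * z) with hB
  have e2 : A.det * B.det = 1 := by
    have := congrArg Matrix.det h1
    rwa [Matrix.det_mul, Matrix.det_one] at this
  have hdetω : ω.det = c := by rw [Matrix.det_unique]
  haveI : Invertible ω :=
    Matrix.invertibleOfIsUnitDet ω (by rw [hdetω]; exact isUnit_iff_ne_zero.mpr hω)
  have hinvω : ⅟ω = c⁻¹ • (1 : Matrix Unit Unit ℝ) := by
    apply invOf_eq_right_inv
    rw [hωc, Matrix.smul_mul, Matrix.one_mul, smul_smul, mul_inv_cancel₀ hω, one_smul]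
  have hW : (Matrix.fromBlocks X y z ω).det = c * B.det := by
    rw [Matrix.det_fromBlocks₂₂, hdetω, hinvω, Matrix.mul_smul, Matrix.mul_one, Matrix.smul_mul]
  have e1 : (Matrix.fromBlocks A r l 0).det * (c * B.det) = 1 := by
    have := congrArg Matrix.det h
    rwa [Matrix.det_mul, Matrix.det_one, hW] at this
  calc A.det = A.det * ((Matrix.fromBlocks A r l 0).det * (c * B.det)) := by rw [e1, mul_one]
    _ = c * (Matrix.fromBlocks A r l 0).det * (A.det * B.det) := by ring
    _ = c * (Matrix.fromBlocks A r l 0).det := by rw [e2, mul_one]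

end Border

/-!
## Addendum (selfsim g4): the CERTIFIED SECTION CENSUS (`skewcut_census_v3.py`, SKEWCUT-CERT-V3 §8.6 (2))

All eigenvalues of a class K-section `T` at once: float eigenvector matrix `V`, its certified
inverse `X` (Rump's test `isUnit_det_of_norm_one_sub_mul_lt` above gives `X V` invertible; the
script certifies `‖1 − X V‖ < 1` and bounds `V⁻¹ T V − B` row-wise for the ball product `B ≈ X T V`),
then Gershgorin's circle theorem (Mathlib `eigenvalue_mem_ball`) moved to the computed matrix `B`:
`eigenvalue_mem_disc_of_similarity`. WHAT THIS IS NOT: not NS evidence; the «isolated disc ⇒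
exactly one eigenvalue» refinement and the section → operator transport stay paper-grade.
-/

section Census

variable {K n : Type*} [NormedField K] [Fintype n] [DecidableEq n]

/-- **Gershgorin after a certified similarity (census enclosure).** Let `T` be a square matrix,
`V` a matrix with a LEFT inverse `X` (`X V = 1`; in the certifier `V` = float eigenvector matrix,
`X` its certified inverse via Rump's test), and `B` ANY matrix (in the certifier: the ball
evaluation of `X T V` up to the certified perturbation) such that every row of `X T V − B` has
`ℓ¹`-mass at most `δ`. Then every eigenvalue `μ` of `T` (with an eigenvector `v ≠ 0`) lies in one
of the discs `‖μ − B k k‖ ≤ Σ_{j ≠ k} ‖B k j‖ + δ`. Proof: `w := X v ≠ 0` is an eigenvector of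
`X T V` for `μ` (since `V X = 1` as well), Gershgorin's theorem (`eigenvalue_mem_ball`) encloses
`μ` in a row disc of `X T V`, and two triangle inequalities move centre and radius to `B`. -/
theorem eigenvalue_mem_disc_of_similarity (T V X B : Matrix n n K) (hXV : X * V = 1)
    {μ : K} {v : n → K} (hv : v ≠ 0) (hT : T.mulVec v = μ • v) {δ : ℝ}
    (hδ : ∀ i, ∑ j, ‖(X * T * V - B) i j‖ ≤ δ) :
    ∃ k, ‖μ - B k k‖ ≤ (∑ j ∈ Finset.univ.erase k, ‖B k j‖) + δ := by
  have hVX : V * X = 1 := mul_eq_one_comm.mp hXV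
  set Bt := X * T * V with hBt
  set w := X.mulVec v with hw
  have hVw : V.mulVec w = v := by
    rw [hw, Matrix.mulVec_mulVec, hVX, Matrix.one_mulVec]
  have hw0 : w ≠ 0 := by
    intro h
    apply hv
    rw [← hVw, h, Matrix.mulVec_zero]
  have hBw : Bt.mulVec w = μ • w := by
    rw [hBt, ← Matrix.mulVec_mulVec, ← Matrix.mulVec_mulVec, hVw, hT, Matrix.mulVec_smul, hw]
  have hμ : Module.End.HasEigenvalue (Matrix.toLin' Bt) μ := by
    refine Module.End.hasEigenvalue_of_hasEigenvector (Module.End.hasEigenvector_iff.mpr ⟨?_, hw0⟩)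
    rw [Module.End.mem_eigenspace_iff, Matrix.toLin'_apply]
    exact hBw
  obtain ⟨k, hk⟩ := eigenvalue_mem_ball hμ
  refine ⟨k, ?_⟩
  rw [Metric.mem_closedBall, dist_eq_norm] at hk
  -- move the centre: ‖μ - B k k‖ ≤ ‖μ - Bt k k‖ + ‖Bt k k - B k k‖
  have h1 : ‖μ - B k k‖ ≤ ‖μ - Bt k k‖ + ‖(Bt - B) k k‖ := by
    calc ‖μ - B k k‖ = ‖(μ - Bt k k) + (Bt - B) k k‖ := by
          congr 1; simp [Matrix.sub_apply]
      _ ≤ ‖μ - Bt k k‖ + ‖(Bt - B) k k‖ := norm_add_le _ _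
  -- move the radius: Σ_{j≠k} ‖Bt k j‖ ≤ Σ_{j≠k} ‖B k j‖ + Σ_{j≠k} ‖(Bt - B) k j‖
  have h2 : ∑ j ∈ Finset.univ.erase k, ‖Bt k j‖
      ≤ ∑ j ∈ Finset.univ.erase k, ‖B k j‖ + ∑ j ∈ Finset.univ.erase k, ‖(Bt - B) k j‖ := by
    rw [← Finset.sum_add_distrib]
    apply Finset.sum_le_sum
    intro j _
    calc ‖Bt k j‖ = ‖B k j + (Bt - B) k j‖ := by congr 1; simp [Matrix.sub_apply]
      _ ≤ ‖B k j‖ + ‖(Bt - B) k j‖ := norm_add_le _ _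
  -- the two perturbation pieces together are at most the full row mass ≤ δ
  have h3 : ‖(Bt - B) k k‖ + ∑ j ∈ Finset.univ.erase k, ‖(Bt - B) k j‖
      = ∑ j, ‖(Bt - B) k j‖ := by
    rw [add_comm, Finset.sum_erase_add _ _ (Finset.mem_univ k)]
  have h4 : ∑ j, ‖(Bt - B) k j‖ ≤ δ := hδ k
  linarith

end Census

end Summit.NavierStokesRegularity.FluidComputer.SkewCutAPosteriori
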